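import Summits.HubbardSuperconductivity.HubbardSuperconductivity.Theorems.AnisotropyChordTransferFibre3N1RowReductions
import Summits.HubbardSuperconductivity.HubbardSuperconductivity.Theorems.AnisotropyChordTransferFibre3ZeroRow
import Summits.HubbardSuperconductivity.HubbardSuperconductivity.Theorems.AnisotropyChordTransferFibre3GreenZero
import Summits.HubbardSuperconductivity.HubbardSuperconductivity.Theorems.AnisotropyChordTransferFibre3Resolvent

/-!
# Route `AnisotropyChord` / H0 rotor rung: PartN41-B §5 CLOSED-PART EXPANSIONS proved

Theory-1 g22's PartN41-B (ported …Fibre3N1Row, p2 g4) §5: the closed per-momentum parts `c(k) = −(2c_s g(k) + d)`,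
`M(k) = 2β²E + ½q²(8 − E)` (`β = c_s g + d/2`, `E = 2ε_T`) summed over `k ≠ 0` / `k ∈ T′ = (ℤ/L)² ∖ {0, −K₁}` are polynomials
in the NAMED one-loop sums `S₁…S₄, T10, G21` (`…Fibre3N1Row` §3, instances of `B1.torSum`).  This file proves all four
§5 targets: ★ `pi2ClosedExpansion_holds`, ★ `axClosedExpansion_holds`, ★ `bClosedExpansion_holds`, ★ `pc0ClosedExpansion_holds`,
after the bridging lemmas `ClosedExp.T10n_eq … G13n_eq` (named two-factor sum = plain torus sum; the one-factor `S1n_eq … S4n_eq`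
and the §4 reductions are p2 g4's …N1RowReductions), `sum_torPrime`, `sum_cos_kx_eq_zero`, `sum_erase_zero_EK` (`Σ_{k≠0} E = 4V`).
Prover seat `hubbard-h0-rotor-p1` g26 (route lead); helper for stmt-HubbardSuperconductivity-23918 (`--supports`, helper class).
WHAT THIS IS NOT: nothing here proves superconductivity in the Hubbard model; exact bookkeeping identities of ONE row of ONE conditional reduction.
Tree imports only; no new definitions; no sorry, no axioms.
-/

set_option linter.dupNamespace false
set_option autoImplicit false

noncomputable section

open scoped BigOperators

namespace Summit.HubbardSuperconductivity.HubbardSuperconductivity.Theorems.AnisotropyChord.Transfer.Fibre3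

variable (L : ℕ) [NeZero L]

namespace ClosedExp

omit [NeZero L] in
/-- `toTor (1,0) = K₁`. [folklore] -/
theorem toTor_one_zero : B1.toTor L ((1 : ℤ), (0 : ℤ)) = K1 L := by
  unfold B1.toTor K1
  simp

omit [NeZero L] in
/-- `g(0) = 0`. [folklore] -/
theorem gres_zero (lam2 : ℝ) : gres L lam2 0 = 0 := by
  unfold gres; simp

/-- the two-factor B1 sum with shifts `(0,0), (1,0)` and powers `i, j`. [folklore] -/
theorem torSum_two (lam2 : ℝ) (i j : ℕ) :
    B1.torSum L lam2 ![((0 : ℤ), (0 : ℤ)), (1, 0)] ![i, j]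
      = ∑ k : Tor L, gres L lam2 k ^ i * gres L lam2 (k + K1 L) ^ j := by
  unfold B1.torSum
  refine Finset.sum_congr rfl fun k _ => ?_
  rw [Fin.prod_univ_two]
  simp only [Matrix.cons_val_zero, Matrix.cons_val_one, Prod.mk_zero_zero, B1.toTor_zero, add_zero,
    toTor_one_zero]

/-- `T10 = Σ g g′`. [folklore] -/
theorem T10n_eq (lam2 : ℝ) : T10n L lam2 = ∑ k : Tor L, gres L lam2 k * gres L lam2 (k + K1 L) := by
  rw [T10n, torSum_two]; simp only [pow_one]
/-- `G21 = Σ g² g′`. [folklore] -/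
theorem G21n_eq (lam2 : ℝ) : G21n L lam2 = ∑ k : Tor L, gres L lam2 k ^ 2 * gres L lam2 (k + K1 L) := by
  rw [G21n, torSum_two]; simp only [pow_one]
/-- `G12 = Σ g g′²`. [folklore] -/
theorem G12n_eq (lam2 : ℝ) : G12n L lam2 = ∑ k : Tor L, gres L lam2 k * gres L lam2 (k + K1 L) ^ 2 := by
  rw [G12n, torSum_two]; simp only [pow_one]
/-- `G22 = Σ g² g′²`. [folklore] -/
theorem G22n_eq (lam2 : ℝ) : G22n L lam2 = ∑ k : Tor L, gres L lam2 k ^ 2 * gres L lam2 (k + K1 L) ^ 2 := by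
  rw [G22n, torSum_two]
/-- `G31 = Σ g³ g′`. [folklore] -/
theorem G31n_eq (lam2 : ℝ) : G31n L lam2 = ∑ k : Tor L, gres L lam2 k ^ 3 * gres L lam2 (k + K1 L) := by
  rw [G31n, torSum_two]; simp only [pow_one]
/-- `G13 = Σ g g′³`. [folklore] -/
theorem G13n_eq (lam2 : ℝ) : G13n L lam2 = ∑ k : Tor L, gres L lam2 k * gres L lam2 (k + K1 L) ^ 3 := by
  rw [G13n, torSum_two]; simp only [pow_one]

/-- `Σ_{k ≠ 0} F = Σ F − F(0)`. [folklore] -/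
theorem sum_erase_zero (F : Tor L → ℝ) :
    ∑ k ∈ (Finset.univ : Finset (Tor L)).erase 0, F k = (∑ k : Tor L, F k) - F 0 := by
  rw [Finset.sum_erase_eq_sub (Finset.mem_univ _)]

/-- `|{k ≠ 0}| = V − 1` (as a real sum of a constant). [folklore] -/
theorem sum_erase_zero_const (c : ℝ) :
    ∑ _k ∈ (Finset.univ : Finset (Tor L)).erase 0, c = ((L : ℝ) ^ 2 - 1) * c := by
  rw [sum_erase_zero, Finset.sum_const, Finset.card_univ, Fintype.card_prod, ZMod.card, nsmul_eq_mul]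
  push_cast; ring

/-- `Σ_k c = V·c`. [folklore] -/
theorem sum_univ_const (c : ℝ) : ∑ _k : Tor L, c = (L : ℝ) ^ 2 * c := by
  rw [Finset.sum_const, Finset.card_univ, Fintype.card_prod, ZMod.card, nsmul_eq_mul]
  push_cast; ring

/-- `T′ = ((ℤ/L)² ∖ {0}) ∖ {−K₁}`. [folklore] -/
theorem torPrime_eq : torPrime L = ((Finset.univ : Finset (Tor L)).erase 0).erase (-K1 L) := by
  ext k
  simp only [torPrime, Finset.mem_filter, Finset.mem_univ, true_and, Finset.mem_erase, and_true, ne_eq,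
    add_eq_zero_iff_eq_neg]
  tauto

/-- `Σ_{k ∈ T′} F = Σ F − F(0) − F(−K₁)` (`L ≥ 2`). [folklore] -/
theorem sum_torPrime (hL : 2 ≤ L) (F : Tor L → ℝ) :
    ∑ k ∈ torPrime L, F k = (∑ k : Tor L, F k) - F 0 - F (-K1 L) := by
  have hK : -K1 L ∈ (Finset.univ : Finset (Tor L)).erase 0 :=
    Finset.mem_erase.2 ⟨neg_ne_zero.2 (K1_ne_zero L hL), Finset.mem_univ _⟩
  rw [torPrime_eq, Finset.sum_erase_eq_sub hK, sum_erase_zero]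

/-- a shifted full torus sum is the unshifted one. [folklore] -/
theorem sum_shift_K1 (F : Tor L → ℝ) : ∑ k : Tor L, F (k + K1 L) = ∑ k : Tor L, F k := by
  exact Fintype.sum_equiv (Equiv.addRight (K1 L)) _ _ (fun k => rfl)

/-- `Σ_k cos kₓ = 0` over the torus (`L ≥ 2`; the row character sum `RateLemma.sum_cos_mul_eq_zero`). [folklore] -/
theorem sum_cos_kx_eq_zero (hL : 2 ≤ L) : ∑ k : Tor L, Real.cos (2 * Real.pi * k.1.val / L) = 0 := by
  rw [Fintype.sum_prod_type]
  simp only [Finset.sum_const, Finset.card_univ, ZMod.card, nsmul_eq_mul]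
  rw [← Finset.mul_sum]
  suffices h : ∑ x : ZMod L, Real.cos (2 * Real.pi * (x.val : ℝ) / (L : ℝ)) = 0 by rw [h, mul_zero]
  obtain ⟨n, hn⟩ : ∃ n, L = n + 1 := ⟨L - 1, by have := NeZero.ne L; omega⟩
  subst hn
  have h := RateLemma.sum_cos_mul_eq_zero (n + 1) 1 Nat.one_pos hL
  rw [← Fin.sum_univ_eq_sum_range] at h
  simp only [Nat.cast_one, mul_one] at h
  exact h

/-- `Σ_k cos k_y = 0` over the torus (`L ≥ 2`). [folklore] -/
theorem sum_cos_ky_eq_zero (hL : 2 ≤ L) : ∑ k : Tor L, Real.cos (2 * Real.pi * k.2.val / L) = 0 := by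
  rw [← sum_cos_kx_eq_zero L hL]
  exact Fintype.sum_equiv (Equiv.prodComm (ZMod L) (ZMod L)) _ _ (fun k => rfl)

/-- `Σ_{k ≠ 0} E(k) = 4V` (`L ≥ 2`). [folklore] -/
theorem sum_erase_zero_EK (hL : 2 ≤ L) :
    ∑ k ∈ (Finset.univ : Finset (Tor L)).erase 0, EK L k = 4 * (L : ℝ) ^ 2 := by
  rw [sum_erase_zero]
  have h0 : EK L 0 = 0 := by unfold EK; rw [epsT_zero]; ring
  have h1 : ∀ k : Tor L, EK L k = 4 - 2 * Real.cos (2 * Real.pi * k.1.val / L)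
      - 2 * Real.cos (2 * Real.pi * k.2.val / L) := by
    intro k; unfold EK epsT; ring
  rw [h0, sub_zero, Finset.sum_congr rfl (fun k _ => h1 k), Finset.sum_sub_distrib, Finset.sum_sub_distrib,
    ← Finset.mul_sum, ← Finset.mul_sum, sum_cos_kx_eq_zero L hL, sum_cos_ky_eq_zero L hL, sum_univ_const]
  ring

/-- `0 < λ₂ < ε₁` forces `L ≥ 2` (`ε₁(1) = 0`). [folklore] -/
theorem two_le_of_pos_lt_eps1 {lam2 : ℝ} (h0 : 0 < lam2) (h1 : lam2 < eps1 L) : 2 ≤ L := by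
  by_contra h
  have hL1 : L = 1 := by have := NeZero.ne L; omega
  have : eps1 L = 0 := by
    unfold eps1; rw [hL1]; simp
  linarith

/-- off the origin the propagator denominator is positive when `0 < λ₂ < ε₁`. [folklore] -/
theorem two_epsT_sub_pos' {lam2 : ℝ} (h0 : 0 < lam2) (h1 : lam2 < eps1 L) (k : Tor L) (hk : k ≠ 0) :
    0 < 2 * epsT L k - lam2 := by
  have := eps1_le_epsT L (two_le_of_pos_lt_eps1 L h0 h1) hk
  linarith

omit [NeZero L] in
/-- `cos` weight at the origin. [folklore] -/
theorem cos_kx_zero : Real.cos (2 * Real.pi * (0 : Tor L).1.val / L) = 1 := by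
  simp

end ClosedExp

open ClosedExp

/-- ★ `Pi2ClosedExpansion L Δ` holds: `Σ_{k≠0} c(k)³ = −[8c³S₃ + 12c²dS₂ + 6cd²S₁ + d³(V − 1)]`. [folklore] -/
theorem pi2ClosedExpansion_holds (Δ : ℝ) : Pi2ClosedExpansion L Δ := by
  intro lam2 f
  dsimp only
  set c := cS L Δ lam2 f
  set d := dPar L Δ f
  have h : ∀ k : Tor L, cK L Δ lam2 f k ^ 3
      = (-(8 * c ^ 3)) * gres L lam2 k ^ 3 + (-(12 * c ^ 2 * d)) * gres L lam2 k ^ 2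
        + (-(6 * c * d ^ 2)) * gres L lam2 k + (-(d ^ 3)) := by
    intro k; unfold cK; ring
  rw [Finset.sum_congr rfl (fun k _ => h k), Finset.sum_add_distrib, Finset.sum_add_distrib, Finset.sum_add_distrib,
    ← Finset.mul_sum, ← Finset.mul_sum, ← Finset.mul_sum, sum_erase_zero_const,
    sum_erase_zero L (fun k => gres L lam2 k ^ 3), sum_erase_zero L (fun k => gres L lam2 k ^ 2),
    sum_erase_zero L (fun k => gres L lam2 k), gres_zero, ← S1n_eq, ← S2n_eq, ← S3n_eq]
  ring

/-- ★ `AxClosedExpansion L Δ` holds: `Σ_{k≠0} c(k)² cos kₓ = 4c²[(1 − λ₂/4)S₂ − S₁/4] + 4cd[(1 − λ₂/4)S₁ − (V − 1)/4] − d²`.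
[folklore] -/
theorem axClosedExpansion_holds (Δ : ℝ) : AxClosedExpansion L Δ := by
  intro lam2 f h0 h1
  dsimp only
  have hL := two_le_of_pos_lt_eps1 L h0 h1
  have hne : ∀ k : Tor L, k ≠ 0 → 2 * epsT L k - lam2 ≠ 0 := fun k hk => (two_epsT_sub_pos' L h0 h1 k hk).ne'
  obtain ⟨hc1, hc2, -, -⟩ := cosWeightedReduction_holds L lam2 hne
  set c := cS L Δ lam2 f
  set d := dPar L Δ f
  have h : ∀ k : Tor L, cK L Δ lam2 f k ^ 2 * Real.cos (2 * Real.pi * k.1.val / L)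
      = (4 * c ^ 2) * (gres L lam2 k ^ 2 * Real.cos (2 * Real.pi * k.1.val / L))
        + (4 * c * d) * (gres L lam2 k * Real.cos (2 * Real.pi * k.1.val / L))
        + d ^ 2 * Real.cos (2 * Real.pi * k.1.val / L) := by
    intro k; unfold cK; ring
  rw [Finset.sum_congr rfl (fun k _ => h k), Finset.sum_add_distrib, Finset.sum_add_distrib,
    ← Finset.mul_sum, ← Finset.mul_sum, ← Finset.mul_sum,
    sum_erase_zero L (fun k => gres L lam2 k ^ 2 * Real.cos (2 * Real.pi * k.1.val / L)),
    sum_erase_zero L (fun k => gres L lam2 k * Real.cos (2 * Real.pi * k.1.val / L)),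
    sum_erase_zero L (fun k => Real.cos (2 * Real.pi * k.1.val / L)),
    hc1, hc2, sum_cos_kx_eq_zero L hL, gres_zero, cos_kx_zero]
  ring

/-- ★ `BClosedExpansion L Δ` holds:
`Σ_{k ∈ T′} c(k)² c(k′) = −[8c³G21 + 4c²d(S₂ − g₁²) + 8c²d T10 + 6cd²(S₁ − g₁) + d³(V − 2)]`. [folklore] -/
theorem bClosedExpansion_holds (Δ : ℝ) : BClosedExpansion L Δ := by
  intro lam2 f h0 h1
  dsimp only
  have hL := two_le_of_pos_lt_eps1 L h0 h1
  set c := cS L Δ lam2 f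
  set d := dPar L Δ f
  have h : ∀ k : Tor L, cK L Δ lam2 f k ^ 2 * cK L Δ lam2 f (k + K1 L)
      = (-(8 * c ^ 3)) * (gres L lam2 k ^ 2 * gres L lam2 (k + K1 L))
        + (-(4 * c ^ 2 * d)) * gres L lam2 k ^ 2
        + (-(8 * c ^ 2 * d)) * (gres L lam2 k * gres L lam2 (k + K1 L))
        + (-(4 * c * d ^ 2)) * gres L lam2 k
        + (-(2 * c * d ^ 2)) * gres L lam2 (k + K1 L) + (-(d ^ 3)) := by
    intro k; unfold cK; ring
  rw [Finset.sum_congr rfl (fun k _ => h k), Finset.sum_add_distrib, Finset.sum_add_distrib, Finset.sum_add_distrib,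
    Finset.sum_add_distrib, Finset.sum_add_distrib, ← Finset.mul_sum, ← Finset.mul_sum, ← Finset.mul_sum,
    ← Finset.mul_sum, ← Finset.mul_sum,
    sum_torPrime L hL (fun k => gres L lam2 k ^ 2 * gres L lam2 (k + K1 L)),
    sum_torPrime L hL (fun k => gres L lam2 k ^ 2),
    sum_torPrime L hL (fun k => gres L lam2 k * gres L lam2 (k + K1 L)),
    sum_torPrime L hL (fun k => gres L lam2 k),
    sum_torPrime L hL (fun k => gres L lam2 (k + K1 L)),
    sum_torPrime L hL (fun _ => -(d ^ 3)),
    sum_shift_K1 L (gres L lam2), sum_univ_const]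
  simp only [neg_add_cancel, zero_add, gres_zero, B1.gres_neg, ← G21n_eq, ← T10n_eq, ← S2n_eq, ← S1n_eq]
  ring

/-- ★ `PC0ClosedExpansion L Δ` holds: `Σ_{k≠0} M(k) c(k) = −(2c·M_g + d·M₀)`. [folklore] -/
theorem pc0ClosedExpansion_holds (Δ : ℝ) : PC0ClosedExpansion L Δ := by
  intro lam2 f h0 h1
  dsimp only
  have hL := two_le_of_pos_lt_eps1 L h0 h1
  have hne : ∀ k : Tor L, k ≠ 0 → 2 * epsT L k - lam2 ≠ 0 := fun k hk => (two_epsT_sub_pos' L h0 h1 k hk).ne'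
  set c := cS L Δ lam2 f
  set d := dPar L Δ f
  set q := qPar L Δ f
  -- termwise, off the origin, using `E g = 1 + λ₂ g`
  have h : ∀ k ∈ (Finset.univ : Finset (Tor L)).erase 0, MK L Δ lam2 f k * cK L Δ lam2 f k
      = (-3 * c * d ^ 2 - 4 * d * q ^ 2 + c * q ^ 2)
        + (-6 * c ^ 2 * d - 3 * c * d ^ 2 * lam2 - 8 * c * q ^ 2 + c * q ^ 2 * lam2) * gres L lam2 k
        + (-4 * c ^ 3 - 6 * c ^ 2 * d * lam2) * gres L lam2 k ^ 2
        + (-4 * c ^ 3 * lam2) * gres L lam2 k ^ 3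
        + (-(d ^ 3 / 2) + d * q ^ 2 / 2) * EK L k := by
    intro k hk
    have hk0 : k ≠ 0 := (Finset.mem_erase.1 hk).1
    have hE := KT1Assembly.two_epsT_mul_gres L lam2 k hk0 (hne k hk0)
    unfold MK betaK cK EK
    linear_combination (-4 * c ^ 3 * gres L lam2 k ^ 2 - 6 * c ^ 2 * d * gres L lam2 k - 3 * c * d ^ 2 + c * q ^ 2) * hE
  rw [Finset.sum_congr rfl h, Finset.sum_add_distrib, Finset.sum_add_distrib, Finset.sum_add_distrib,
    Finset.sum_add_distrib, ← Finset.mul_sum, ← Finset.mul_sum, ← Finset.mul_sum, ← Finset.mul_sum,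
    sum_erase_zero_const, sum_erase_zero_EK L hL,
    sum_erase_zero L (fun k => gres L lam2 k), sum_erase_zero L (fun k => gres L lam2 k ^ 2),
    sum_erase_zero L (fun k => gres L lam2 k ^ 3), gres_zero, ← S1n_eq, ← S2n_eq, ← S3n_eq]
  ring

end Summit.HubbardSuperconductivity.HubbardSuperconductivity.Theorems.AnisotropyChord.Transfer.Fibre3

end
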